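import Mathlib

/-!
# The resolvent expectation of a split vector: exact all-`N` criterion for free-constant domination

Conjunct `BoseEinsteinCondensation` of `AtomisticToContinuum` — soloist report `paper/sharpest.md`
§4.10(ix).  Companion to `SoloInformedTwoBodyDomination`: the same two applications of the weak inverse,
but for an ARBITRARY split `h f = κ f + F` of a symmetric `h` (no eigenvector structure needed), which
is the form available for every particle number.

Abstract statements (inner product space over `ℂ`, `h` a symmetric linear map, `κ ≠ 0` real,
`h f = κ f + F`, `h u = F`, `g := κ⁻¹ (f − u)`):

* `SoloInformed.split_weakInverse` — `h g = f`;
* `SoloInformed.split_resolvent_identity` — `re⟨f, g⟩ · κ² = ‖f‖² κ − (re⟨F, f⟩ − re⟨F, u⟩)`;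
* `SoloInformed.split_domination_iff` — for `0 < κ`, `0 < ε`:
  `re⟨f, g⟩ ≤ 1/ε ↔ re⟨F, u⟩ ≤ re⟨F, f⟩ + κ (κ/ε − ‖f‖²)`.

Physical reading (torus or lattice `Λ`, pair interaction `v`, `N`-particle ground state `Ψ₀`,
`f = a_k† Ψ₀`, `h = H_{N+1} − E₀(N+1) ≥ 0`).  The commutator
`[V, a_k†] = |Λ|⁻¹ Σ_q v̂(q) a†_{k−q} ρ_q` gives the split with
`κ = κ_N(k) := ε(k) + ρ v̂(0) − μ_N` (`μ_N = E₀(N+1) − E₀(N)`) and the interaction current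
`F = F_k := |Λ|⁻¹ Σ_{q ≠ 0} v̂(q) a†_{k−q} ρ_q Ψ₀`; `re⟨f, g⟩ = χ₊(k)`, `‖f‖² = 1 + n_k`, and
`re⟨F, u⟩ = ⟨F_k, h⁻¹ F_k⟩`.  The third statement is then the exact criterion
`χ₊(k) ε(k) ≤ 1 ⟺ ⟨F_k, h⁻¹F_k⟩ ≤ ⟨F_k, f⟩ + κ_N(k) [ρ v̂(0) − μ_N − ε(k) n_k] / ε(k)`:
free-constant `T = 0` Gaussian domination in the particle channel holds iff the second-order
particle-addition self-energy at the pole does not exceed the first-order exchange `⟨F_k, f⟩`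
(`≈ ρ₀ v̂(k) (1 + n_k + α_k)`) plus the Hartree margin.  For `N = 1` it reduces to the two-body
criterion of `SoloInformedTwoBodyDomination`.  The algebra is trivial; the content of the report's
conjecture (GD₀) is the missing upper bound on `⟨F_k, h⁻¹ F_k⟩` uniformly in `N, L`.
-/

noncomputable section

open Complex
open scoped InnerProductSpace ComplexConjugate

namespace Summit.AtomisticToContinuum.BoseEinsteinCondensation.Theorems

universe v

variable {E : Type v} [NormedAddCommGroup E] [InnerProductSpace ℂ E]

section Split

variable {h : E →ₗ[ℂ] E} {f u F : E} {κ : ℝ}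

/-- `g := κ⁻¹ (f − u)` is a weak inverse, `h g = f`, given `h f = κ f + F`, `h u = F`, `κ ≠ 0`. -/
theorem SoloInformed.split_weakInverse (hf : h f = (κ : ℂ) • f + F) (hu : h u = F) (hκ : κ ≠ 0) :
    h (((κ : ℝ) : ℂ)⁻¹ • (f - u)) = f := by
  have hne : ((κ : ℝ) : ℂ) ≠ 0 := Complex.ofReal_ne_zero.mpr hκ
  rw [map_smul, map_sub, hf, hu, add_sub_cancel_right, smul_smul, inv_mul_cancel₀ hne, one_smul]

/-- **Resolvent identity for a split vector**: if `h` is symmetric, `h f = κ f + F`, `h u = F` and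
`g = κ⁻¹ (f − u)` (so `h g = f` when `κ ≠ 0`),
`re⟨f, g⟩ · κ² = ‖f‖² κ − (re⟨F, f⟩ − re⟨F, u⟩)`. [folklore: second resolvent identity] -/
theorem SoloInformed.split_resolvent_identity
    (hh : ∀ x y : E, ⟪h x, y⟫_ℂ = ⟪x, h y⟫_ℂ)
    (hf : h f = (κ : ℂ) • f + F) (hu : h u = F) :
    (⟪f, ((κ : ℝ) : ℂ)⁻¹ • (f - u)⟫_ℂ).re * κ ^ 2
      = ‖f‖ ^ 2 * κ - ((⟪F, f⟫_ℂ).re - (⟪F, u⟫_ℂ).re) := by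
  -- (true also for κ = 0, where both sides vanish by symmetry of h)
  rcases eq_or_ne κ 0 with hκ0 | hκ
  · subst hκ0
    have h1 : ⟪h f, u⟫_ℂ = ⟪f, F⟫_ℂ := by rw [hh, hu]
    rw [hf] at h1
    simp only [Complex.ofReal_zero, zero_smul, zero_add] at h1
    have : (⟪F, u⟫_ℂ).re = (⟪F, f⟫_ℂ).re := by
      rw [h1, ← inner_conj_symm f F, Complex.conj_re]
    simp [this]
  -- ⟨h f, u⟩ = ⟨f, h u⟩ = ⟨f, F⟩, and ⟨h f, u⟩ = κ⟨f, u⟩ + ⟨F, u⟩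
  have h1 : ⟪h f, u⟫_ℂ = ⟪f, F⟫_ℂ := by rw [hh, hu]
  have h2 : ⟪h f, u⟫_ℂ = ((κ : ℝ) : ℂ) * ⟪f, u⟫_ℂ + ⟪F, u⟫_ℂ := by
    rw [hf, inner_add_left, inner_smul_left, Complex.conj_ofReal]
  have h3 : ((κ : ℝ) : ℂ) * ⟪f, u⟫_ℂ = ⟪f, F⟫_ℂ - ⟪F, u⟫_ℂ := by
    have := h1.symm.trans h2
    linear_combination -this
  have h3re : κ * (⟪f, u⟫_ℂ).re = (⟪F, f⟫_ℂ).re - (⟪F, u⟫_ℂ).re := by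
    have := congrArg Complex.re h3
    rw [Complex.re_ofReal_mul, Complex.sub_re] at this
    rw [this, ← inner_conj_symm f F, Complex.conj_re]
  have hff : (⟪f, f⟫_ℂ).re = ‖f‖ ^ 2 := by
    rw [← inner_self_eq_norm_sq (𝕜 := ℂ) f]; rfl
  rw [inner_smul_right, ← Complex.ofReal_inv, Complex.re_ofReal_mul, inner_sub_right,
    Complex.sub_re, hff]
  field_simp
  linear_combination (-1 : ℝ) * h3re

/-- **Exact criterion for free-constant domination.**  In the setting of
`SoloInformed.split_resolvent_identity` with `0 < κ` and `0 < ε`: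
`re⟨f, g⟩ ≤ 1/ε ↔ re⟨F, u⟩ ≤ re⟨F, f⟩ + κ (κ/ε − ‖f‖²)`.  Physical reading:
`χ₊(k) ε(k) ≤ 1 ⟺ ⟨F_k, h⁻¹F_k⟩ ≤ ⟨F_k, a_k†Ψ₀⟩ + κ_N(k)[ρ v̂(0) − μ_N − ε(k) n_k]/ε(k)`.
[report §4.10(ix)] -/
theorem SoloInformed.split_domination_iff
    (hh : ∀ x y : E, ⟪h x, y⟫_ℂ = ⟪x, h y⟫_ℂ)
    (hf : h f = (κ : ℂ) • f + F) (hu : h u = F) {ε : ℝ} (hκ : 0 < κ) (hε : 0 < ε) :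
    (⟪f, ((κ : ℝ) : ℂ)⁻¹ • (f - u)⟫_ℂ).re ≤ 1 / ε ↔
      (⟪F, u⟫_ℂ).re ≤ (⟪F, f⟫_ℂ).re + κ * (κ / ε - ‖f‖ ^ 2) := by
  have hid := SoloInformed.split_resolvent_identity hh hf hu
  set χ := (⟪f, ((κ : ℝ) : ℂ)⁻¹ • (f - u)⟫_ℂ).re with hχ
  have hκ2 : 0 < κ ^ 2 := pow_pos hκ 2
  constructor
  · intro hle
    have h1 : χ * κ ^ 2 ≤ (1 / ε) * κ ^ 2 := mul_le_mul_of_nonneg_right hle hκ2.le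
    rw [hid] at h1
    have h2 : (1 / ε) * κ ^ 2 = κ * (κ / ε) := by field_simp
    nlinarith [h1, h2]
  · intro hX
    have h1 : χ * κ ^ 2 ≤ (1 / ε) * κ ^ 2 := by
      rw [hid]
      have h2 : (1 / ε) * κ ^ 2 = κ * (κ / ε) := by field_simp
      nlinarith [hX, h2]
    exact le_of_mul_le_mul_right h1 hκ2

end Split

end Summit.AtomisticToContinuum.BoseEinsteinCondensation.Theorems

end
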